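import Summits.BirchSwinnertonDyer.BirchSwinnertonDyer.Theorems.UniversalToricDescentWildSplitControlAtThreeOfSerre1967
import HarnessLib

/-!
# Route `UniversalToricDescent` — glue item `WildSplitControlAtThreeOfPublishedFacts`
# (stmt-BirchSwinnertonDyer-20468) BY NAME

Seat `bsd-potss-kmc`, gen 18 (cell `bsd-potss`; kernel service on bsd-wall-pss3's route
`UniversalToricDescent`, rev 11). The planner split crux #5 `WildSplitControlAtThree`
(stmt-BirchSwinnertonDyer-20386) into seven published-fact leaves
(`PoitouTateSelmerStructureDualityFact`, `PoitouTateShaTateDualFact`,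
`LocalEulerPoincareCharacteristicFact`, `NumberFieldCdLETwoFact`,
`BrinkSplitPrimesFinitelyDecomposedFact`, `BrinkPrimesAbovePNotSplitFact`,
`SerrePotentiallySupersingularNoStableLineFact`) and this glue; the glue is gen 17's landed closer
`UniversalToricDescentControl.wildSplitControlAtThree_of_facts_of_serre1967` (p526934), whose binder
order is the children's order. HONEST FRAMING: pure logic over that theorem; the seven leaves stay
cite-level named facts (two of them tree theorems); BSD is not proved by any of this.

References: [JetchevSkinnerWan2017] Thm. 3.3.1; [Serre1967GroupesPDivisibles] §5 Prop. 8.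
-/

set_option linter.dupNamespace false

namespace Summit.BirchSwinnertonDyer.BirchSwinnertonDyer.Theorems

open Summit.BirchSwinnertonDyer.BirchSwinnertonDyer.Theses.UniversalToricDescent

/-- **Glue `WildSplitControlAtThreeOfPublishedFacts` (item 20468) holds**: the seven published-fact
leaves imply crux #5 `WildSplitControlAtThree`, by gen 17's closer
`wildSplitControlAtThree_of_facts_of_serre1967` (Poitou–Tate ×2, local Euler–Poincaré, `cd ≤ 2`,
Brink Thm 2 / Cor 1, Serre 1967 Prop. 8 ⟹ Jetchev–Skinner–Wan's anticyclotomic control count at the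
potentially supersingular split `3`). [cite: JetchevSkinnerWan2017, Thm. 3.3.1]
[cite: Serre1967GroupesPDivisibles, §5 Prop. 8] -/
theorem wildSplitControlAtThreeOfPublishedFacts_proof : WildSplitControlAtThreeOfPublishedFacts := by
  unfold WildSplitControlAtThreeOfPublishedFacts
  intro h1 h2 h3 h4 h5 h6 h7
  exact UniversalToricDescentControl.wildSplitControlAtThree_of_facts_of_serre1967 h1 h2 h3 h4 h5 h6 h7

end Summit.BirchSwinnertonDyer.BirchSwinnertonDyer.Theorems
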